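import Summits.NavierStokesRegularity.NavierStokesRegularity.Theses.AdaptedFrequency
import Literature.Analysis.FluidPDE.AdaptedBackwardKernel

/-!
# Line `similarity-ou-harnack-chain` for crux `AdaptedFrequency.AdaptedKernelExists`
# (stmt-NavierStokesRegularity-2956)

Skeleton (crux-plan, planner-cruxplan-stmt-NavierStokesRegularity-2956-similarity-ou-harnac-0,
2026-08-16) of crux idea `Cruxes/AdaptedKernelExists/Ideas/similarity-ou-harnack-chain.md`
(crux-ideate r1 ideator 1; triage r1-1: **pass**, two sharpenings, both built in below).

THE CRUX (fixed, route decl `AdaptedFrequency.AdaptedKernelExists`, rank 4): for a classical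
Leray–Hopf solution from a rapidly decaying datum with the Type-I rate at `T`, at EVERY `x₀` there is
a window `[t₀,T)` and a flow-adapted backward kernel `G` (C², `G > 0`, `∂ₜG + u·∇G + νΔG = 0`,
`∫G = 1`, `G(t) ⇀ δ_{x₀}`) which is two-sided Gaussian-comparable down to `T`.

THE LINE. Nothing of Navier–Stokes is used except `div u = 0`, smoothness, and the time-only rate
`‖u(t)‖∞ ≤ C/√(T−t)`: the crux is the special case `b = u` of the LINEAR, dilation-invariant statement
`LinearTypeIDriftKernel` (C⁺ of the card; constants depending on `(ν, C)` only), and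
`adaptedKernelExists_of_linear : LinearTypeIDriftKernel → AdaptedKernelExists` is proved below.
In similarity variables `y = (x−x₀)/√(T−t)`, `s = log (T−t)`, `G = (T−t)^{-3/2} Φ(s,y)`, the adjoint
equation is the Fokker–Planck equation `∂ₛΦ = νΔΦ + ∇·((y/2)Φ) + β·∇Φ` run FORWARD in `s` from
`s = −∞` (the pole), with the Ornstein–Uhlenbeck confinement `y/2` supplied by the parabolic
rescaling and a bounded divergence-free perturbation `β = √(T−t)·b`, `‖β‖ ≤ C` — the time-only Type-I
bound is EXACTLY boundedness of the similarity drift, so nothing is critical any more; the only issue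
is uniformity over the infinite `s`-interval, an ergodic question answered by a Lyapunov moment.
C⁺ is cut into four A-PRIORI estimates (constants `(ν, C)` only) and two EXISTENCE steps:

* `stub_expMoment` (E, LEVER 1 — OU confinement): Lyapunov weight `V = e^{‖y‖²/(8ν)}`,
  `L*V ≤ K₂ − V` using only `‖β‖ ≤ C` (`λ = 1/(8ν) < 1/(4ν)`); for an eternal solution whose moment is
  a priori bounded (the qualitative "heat class" hypothesis) the relaxation `dM/ds ≤ K₂ − M` from
  `s = −∞` gives `∫ e^{‖x−x₀‖²/(8ν(T−t))} G(t,x) dx ≤ M(ν,C)` at every time.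
* `stub_gaussianUpper`: the moment bound + Lieberman's local maximum principle (Thm 6.17, PROVED in
  tree, drift bound uniform) on one parabolic cylinder of size `≍ √(T−t)` ⇒
  `G ≤ C₁(T−t)^{-3/2}e^{−‖x−x₀‖²/(C₂(T−t))}`.
* `stub_bulkPositivity`: the moment bound ⇒ mass `≥ ½` in `B(x₀, R√(T−t'))` (Chebyshev) ⇒ by the
  tree's mass-to-pointwise Gaussian comparison (`IsDriftHeatSolutionOn.mass_to_pointwise`) a lower
  bound `G ≥ c₀(T−t)^{-3/2}` on the parabolic bulk `‖x−x₀‖ ≤ R√(T−t)`.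
* `stub_harnackChain` (LEVER 2 — the card's First lemma): a Harnack chain of `N ≍ r²` two-point
  Harnack steps (tree: `exists_twoPointHarnack`, `IsTwoPointHarnackConst.chain`, ONE constant `θ₀`
  because radius × drift stays bounded) from the bulk out to `‖x−x₀‖ = r√(T−t)`, consuming only
  physical times in `(t,T)`, costs `θ₀^{−N} = e^{−O(r²)}`: the Gaussian LOWER bound.
* `stub_cutoffKernel` (existence, regular pole): for a smooth bounded divergence-free drift that
  VANISHES near the pole, an adapted kernel exists and lies in the heat class (explicit backward heat
  kernel near the pole, a smooth-coefficient backward Cauchy problem with Gaussian terminal datum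
  below it; upper barrier = the tree's drift-robust kernel `driftKernel 1 A`).
* `stub_kernelLimit` (existence by approximation, HARDEST in Lean): smooth temporal cut-off
  `χ·b` of a Type-I drift is Type-I with the SAME constant w.r.t. every earlier pole `T̂ ≤ T`
  (triage sharpening 1: smooth cut-off, not padding by `0`); the a-priori package gives uniform
  two-sided bounds for the cut-off kernels; interior parabolic estimates give local `C²` compactness
  as `T̂ ↑ T`; mass, positivity and the bounds pass to the limit, and concentration at `x₀` follows
  from the uniform UPPER bound + unit mass alone (triage sharpening 2).
* Composition (kernel-checked, sorry-free): `aPriori_of` (E ⇒ moment ⇒ upper & bulk ⇒ lower, pure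
  logic), `linear_of`, `adaptedKernelExists_of_linear` (the transfer: `t₀ := max 0 ((t₁+T)/2)` from
  the `𝓝[<] T` window of `IsTypeIBlowup`, `C ↦ max C 0`), `AdaptedKernelExists_of`.

Disproof.lean: NONE filed for this crux at planning time (`ledger crux ls stmt-NavierStokesRegularity-2956`:
Ideas ×4 + TRIAGE-r1-1 only; payload disproof_path absent on disk), so no `_false_without_<H>`
obstruction and no landed `Theorems/AdaptedKernelExists/Negative/*` lemma exists to honour or import;
the line nevertheless records which hypothesis each stub uses (H = Type-I rate: stubs E/upper/bulk/
chain through the drift bound at scale `√(T−t)`; H = `div b = 0`: mass conservation in E and in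
cutoffKernel; smoothness: integration by parts on compact sets only). Negatives index
(`ledger negatives --problem NavierStokesRegularity`, 2026-08-16): 1 refuted statement
(BlowupBlowupClayNonuniqueness, stmt-0154) — unrelated; no stub is an instance of it.
Recorded dead approach on the item (refuter note 2026-08-15): naive dyadic-block chaining of Aronson
bounds (constants multiply). This line never multiplies block constants: across scales only the
moment (E) is propagated, by a CLOSED differential inequality in log-time (an invariant interval),
and the Harnack chain runs in space at fixed scale with `N(r) ≍ r²` steps — the price of a Gaussian.
-/

noncomputable section

namespace Summit.NavierStokesRegularity.NavierStokesRegularity.Cruxes.AdaptedKernelExists.SimilarityOuHarnackChain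

open MeasureTheory Set Filter Topology
open Literature.Analysis.FluidPDE
open Summit.NavierStokesRegularity.NavierStokesRegularity.Theses.AdaptedFrequency

set_option linter.unusedVariables false
set_option linter.dupNamespace false

/-! ## Vocabulary (abbreviations over existing declarations; no new mathematics) -/

/-- Physical space `ℝ³`. -/
abbrev E3 := EuclideanSpace ℝ (Fin 3)

/-- **Type-I divergence-free drift** on `[t₀,T) × ℝ³` with constant `C`: jointly smooth
(`IsSmoothSpaceTimeOn`), divergence free at every time, and `‖b(t,x)‖ ≤ C/√(T−t)` — the three
properties of the velocity that the line uses (for `b = u` they come from `IsClassicalNSSolutionOn`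
and `IsTypeIBlowup`, see `adaptedKernelExists_of_linear`). Dilation/translation invariant with the
same `C`. -/
def IsTypeIDrift (C : ℝ) (b : ℝ → E3 → E3) (t₀ T : ℝ) : Prop :=
  IsSmoothSpaceTimeOn (Ico t₀ T) b ∧ (∀ t ∈ Ico t₀ T, VectorCalculus.IsDivFree (b t)) ∧
    ∀ t ∈ Ico t₀ T, ∀ x, ‖b t x‖ ≤ C / Real.sqrt (T - t)

/-- Gaussian LOWER bound `c₁ (T−t)^{-3/2} e^{−‖x−x₀‖²/(c₂(T−t))} ≤ G(t,x)` on `[t₀,T) × ℝ³`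
(verbatim the lower half of the crux's comparability clause). -/
def HasGaussianLowerBound (c₁ c₂ : ℝ) (G : ℝ → E3 → ℝ) (t₀ T : ℝ) (x₀ : E3) : Prop :=
  ∀ t ∈ Ico t₀ T, ∀ x,
    c₁ * (T - t) ^ (-(3:ℝ) / 2) * Real.exp (-(‖x - x₀‖ ^ 2) / (c₂ * (T - t))) ≤ G t x

/-- Gaussian UPPER bound `G(t,x) ≤ C₁ (T−t)^{-3/2} e^{−‖x−x₀‖²/(C₂(T−t))}` on `[t₀,T) × ℝ³`
(verbatim the upper half of the crux's comparability clause). -/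
def HasGaussianUpperBound (C₁ C₂ : ℝ) (G : ℝ → E3 → ℝ) (t₀ T : ℝ) (x₀ : E3) : Prop :=
  ∀ t ∈ Ico t₀ T, ∀ x,
    G t x ≤ C₁ * (T - t) ^ (-(3:ℝ) / 2) * Real.exp (-(‖x - x₀‖ ^ 2) / (C₂ * (T - t)))

/-- **Heat class** (the QUALITATIVE hypothesis of the a-priori estimates): some Gaussian upper bound
`G ≤ K (T−t)^{-3/2} e^{−‖x−x₀‖²/(C₂'(T−t))}` at a rate `0 < C₂' < 8ν` (the heat kernel has `4ν`), with
ARBITRARY constants `K, C₂'` — what the cut-off kernels of `stub_cutoffKernel` visibly have (heat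
kernel near the pole, drift-robust barrier below it: rate `6ν`), and exactly what makes the
Lyapunov moment at rate `1/(8ν)` finite and bounded a priori, uniformly in `t`. -/
def InHeatClass (ν : ℝ) (G : ℝ → E3 → ℝ) (t₀ T : ℝ) (x₀ : E3) : Prop :=
  ∃ K C₂' : ℝ, 0 < C₂' ∧ C₂' < 8 * ν ∧ HasGaussianUpperBound K C₂' G t₀ T x₀

/-- **Sub-Gaussian similarity moment bound** at rate `λ = 1/(8ν)`:
`∫ e^{‖x−x₀‖²/(8ν(T−t))} G(t,x) dx ≤ M` at every `t ∈ [t₀,T)`, the integrand being integrable (so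
the Bochner integral is the true one). In similarity variables: `∫ e^{‖y‖²/(8ν)} Φ(s,y) dy ≤ M`
for all `s`. -/
def HasExpMomentBound (ν M : ℝ) (G : ℝ → E3 → ℝ) (t₀ T : ℝ) (x₀ : E3) : Prop :=
  ∀ t ∈ Ico t₀ T,
    Integrable (fun x => Real.exp (‖x - x₀‖ ^ 2 / (8 * ν * (T - t))) * G t x) ∧
      ∫ x, Real.exp (‖x - x₀‖ ^ 2 / (8 * ν * (T - t))) * G t x ≤ M

/-- **Bulk positivity**: `G(t,x) ≥ c₀ (T−t)^{-3/2}` on the parabolic bulk `‖x−x₀‖ ≤ R√(T−t)`. -/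
def HasBulkLowerBound (R c₀ : ℝ) (G : ℝ → E3 → ℝ) (t₀ T : ℝ) (x₀ : E3) : Prop :=
  ∀ t ∈ Ico t₀ T, ∀ x, ‖x - x₀‖ ≤ R * Real.sqrt (T - t) → c₀ * (T - t) ^ (-(3:ℝ) / 2) ≤ G t x

/-! ## The six stub statements (named `Prop`s; the registered `theorem stub_X` below restates the SAME text
expanded, so the registered signature is the real statement, and `stub_X : <NamedStatement>` holds by `δ`-unfolding) -/

/-- (E) Statement of `stub_expMoment`. -/
def ExpMomentBound : Prop :=
  ∀ ν C : ℝ, 0 < ν → 0 ≤ C → ∃ M : ℝ, 0 < M ∧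
    ∀ (t₀ T : ℝ) (b : ℝ → E3 → E3) (x₀ : E3) (G : ℝ → E3 → ℝ), t₀ < T →
      IsTypeIDrift C b t₀ T → IsAdaptedBackwardKernel ν b (Ico t₀ T) T x₀ G →
        InHeatClass ν G t₀ T x₀ → HasExpMomentBound ν M G t₀ T x₀

/-- Statement of `stub_gaussianUpper`. -/
def GaussianUpperFromMoment : Prop :=
  ∀ ν C M : ℝ, 0 < ν → 0 ≤ C → ∃ C₁ C₂ : ℝ, 0 < C₁ ∧ 0 < C₂ ∧
    ∀ (t₀ T : ℝ) (b : ℝ → E3 → E3) (x₀ : E3) (G : ℝ → E3 → ℝ), t₀ < T →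
      IsTypeIDrift C b t₀ T → IsAdaptedBackwardKernel ν b (Ico t₀ T) T x₀ G →
        HasExpMomentBound ν M G t₀ T x₀ → HasGaussianUpperBound C₁ C₂ G t₀ T x₀

/-- Statement of `stub_bulkPositivity`. -/
def BulkPositivityFromMoment : Prop :=
  ∀ ν C M : ℝ, 0 < ν → 0 ≤ C → ∃ R c₀ : ℝ, 0 < R ∧ 0 < c₀ ∧
    ∀ (t₀ T : ℝ) (b : ℝ → E3 → E3) (x₀ : E3) (G : ℝ → E3 → ℝ), t₀ < T →
      IsTypeIDrift C b t₀ T → IsAdaptedBackwardKernel ν b (Ico t₀ T) T x₀ G →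
        HasExpMomentBound ν M G t₀ T x₀ → HasBulkLowerBound R c₀ G t₀ T x₀

/-- Statement of `stub_harnackChain` (the idea card's First lemma, verbatim up to vocabulary). -/
def HarnackChainLowerBound : Prop :=
  ∀ ν C R c₀ : ℝ, 0 < ν → 0 ≤ C → 0 < R → 0 < c₀ → ∃ c₁ c₂ : ℝ, 0 < c₁ ∧ 0 < c₂ ∧
    ∀ (t₀ T : ℝ) (b : ℝ → E3 → E3) (x₀ : E3) (G : ℝ → E3 → ℝ), t₀ < T →
      IsTypeIDrift C b t₀ T → IsAdaptedBackwardKernel ν b (Ico t₀ T) T x₀ G →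
        HasBulkLowerBound R c₀ G t₀ T x₀ → HasGaussianLowerBound c₁ c₂ G t₀ T x₀

/-- Statement of `stub_cutoffKernel`. -/
def CutoffKernelExists : Prop :=
  ∀ (ν t₀ T : ℝ) (b : ℝ → E3 → E3) (x₀ : E3), 0 < ν → t₀ < T →
    IsSmoothSpaceTimeOn (Ico t₀ T) b → (∀ t ∈ Ico t₀ T, VectorCalculus.IsDivFree (b t)) →
    (∃ B : ℝ, ∀ t ∈ Ico t₀ T, ∀ x, ‖b t x‖ ≤ B) →
    (∃ T₁ ∈ Ioo t₀ T, ∀ t ∈ Ico T₁ T, ∀ x, b t x = 0) →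
      ∃ G : ℝ → E3 → ℝ, IsAdaptedBackwardKernel ν b (Ico t₀ T) T x₀ G ∧ InHeatClass ν G t₀ T x₀

/-- **The a-priori package** (conclusion of stubs 1–4 combined by `aPriori_of`): uniform two-sided
Gaussian bounds, constants depending on `(ν, C)` only, for EVERY heat-class adapted kernel of EVERY
Type-I divergence-free drift. -/
def APrioriTwoSided : Prop :=
  ∀ ν C : ℝ, 0 < ν → 0 ≤ C → ∃ c₁ c₂ C₁ C₂ : ℝ, 0 < c₁ ∧ 0 < c₂ ∧ 0 < C₁ ∧ 0 < C₂ ∧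
    ∀ (t₀ T : ℝ) (b : ℝ → E3 → E3) (x₀ : E3) (G : ℝ → E3 → ℝ), t₀ < T →
      IsTypeIDrift C b t₀ T → IsAdaptedBackwardKernel ν b (Ico t₀ T) T x₀ G →
        InHeatClass ν G t₀ T x₀ →
          HasGaussianLowerBound c₁ c₂ G t₀ T x₀ ∧ HasGaussianUpperBound C₁ C₂ G t₀ T x₀

/-- **C⁺ = `LinearTypeIDriftKernel`** (the card's Transfer target; STRONGER than the crux): for
`ν > 0`, `C ≥ 0` there are `c₁, c₂, C₁, C₂ > 0` depending ONLY on `(ν, C)` such that every Type-I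
divergence-free smooth drift on `[t₀,T) × ℝ³` admits, at every `x₀`, an adapted backward kernel on
`Ico t₀ T` with pole `(T, x₀)` obeying these two-sided Gaussian bounds. -/
def LinearTypeIDriftKernel : Prop :=
  ∀ ν C : ℝ, 0 < ν → 0 ≤ C → ∃ c₁ c₂ C₁ C₂ : ℝ, 0 < c₁ ∧ 0 < c₂ ∧ 0 < C₁ ∧ 0 < C₂ ∧
    ∀ (t₀ T : ℝ) (b : ℝ → E3 → E3) (x₀ : E3), t₀ < T → IsTypeIDrift C b t₀ T →
      ∃ G : ℝ → E3 → ℝ, IsAdaptedBackwardKernel ν b (Ico t₀ T) T x₀ G ∧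
        HasGaussianLowerBound c₁ c₂ G t₀ T x₀ ∧ HasGaussianUpperBound C₁ C₂ G t₀ T x₀

/-- Statement of `stub_kernelLimit`: existence by approximation, WITH THE SAME CONSTANTS — if every
heat-class adapted kernel of every Type-I(`C`) drift obeys the two-sided bounds with constants
`(c₁,c₂,C₁,C₂)`, and cut-off kernels exist, then every Type-I(`C`) drift has an adapted kernel with
exactly these constants (the limit of cut-off kernels inherits the non-strict bounds). -/
def KernelLimit : Prop :=
  ∀ ν C c₁ c₂ C₁ C₂ : ℝ, 0 < ν → 0 ≤ C → 0 < c₁ → 0 < c₂ → 0 < C₁ → 0 < C₂ →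
    (∀ (t₀ T : ℝ) (b : ℝ → E3 → E3) (x₀ : E3) (G : ℝ → E3 → ℝ), t₀ < T →
      IsTypeIDrift C b t₀ T → IsAdaptedBackwardKernel ν b (Ico t₀ T) T x₀ G →
        InHeatClass ν G t₀ T x₀ →
          HasGaussianLowerBound c₁ c₂ G t₀ T x₀ ∧ HasGaussianUpperBound C₁ C₂ G t₀ T x₀) →
    CutoffKernelExists →
      ∀ (t₀ T : ℝ) (b : ℝ → E3 → E3) (x₀ : E3), t₀ < T → IsTypeIDrift C b t₀ T →
        ∃ G : ℝ → E3 → ℝ, IsAdaptedBackwardKernel ν b (Ico t₀ T) T x₀ G ∧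
          HasGaussianLowerBound c₁ c₂ G t₀ T x₀ ∧ HasGaussianUpperBound C₁ C₂ G t₀ T x₀

/-! ### Name-keyed aliases of the six statements (the hypotheses of the composition)

`Registered.stub_X` is the statement of `stub_X` under the registered stub's short name, so that the
native skeleton audit (`#h21_check_skeleton`: hypotheses admissible iff registered obligations /
declared stubs BY NAME) accepts `AdaptedKernelExists_of : Registered.stub_expMoment → … →
AdaptedKernelExists` (device of `Cruxes/NoisyFourier/Lines/half-conserved-witness.lean`; the
`@[stub]` tag itself is gate-reserved). Each alias is `rfl`-equal to the named statement. -/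
namespace Registered

/-- Alias of `ExpMomentBound` keyed by the registered stub name. -/
abbrev stub_expMoment : Prop := ExpMomentBound
/-- Alias of `GaussianUpperFromMoment` keyed by the registered stub name. -/
abbrev stub_gaussianUpper : Prop := GaussianUpperFromMoment
/-- Alias of `BulkPositivityFromMoment` keyed by the registered stub name. -/
abbrev stub_bulkPositivity : Prop := BulkPositivityFromMoment
/-- Alias of `HarnackChainLowerBound` keyed by the registered stub name. -/
abbrev stub_harnackChain : Prop := HarnackChainLowerBound
/-- Alias of `CutoffKernelExists` keyed by the registered stub name. -/
abbrev stub_cutoffKernel : Prop := CutoffKernelExists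
/-- Alias of `KernelLimit` keyed by the registered stub name. -/
abbrev stub_kernelLimit : Prop := KernelLimit

end Registered

/-! ## Registered stubs (the ONLY `sorry`s of the file) -/

/-- **(E) `stub_expMoment` — the Ornstein–Uhlenbeck Lyapunov moment (LEVER 1).** For every heat-class
adapted kernel `G` of a Type-I divergence-free drift (constant `C`) on `[t₀,T)`,
`∫ e^{‖x−x₀‖²/(8ν(T−t))} G(t,x) dx ≤ M(ν,C)` at EVERY `t ∈ [t₀,T)` (integrand integrable).
Why plausibly true (triage r1-1 re-derived the algebra): with `G = (T−t)^{-3/2}Φ(s,y)`,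
`y = (x−x₀)/√(T−t)`, `s = log(T−t)`, the adjoint equation is `∂ₛΦ = νΔΦ + ∇·((y/2)Φ) + ∇·(βΦ)`
(`β = √(T−t)·b`, `‖β‖ ≤ C`, `div β = 0`), evolving forward in `s` from the pole `s = −∞`; for
`V = e^{λ‖y‖²}`, `L*V = νΔV − (y/2 + β)·∇V = V[6λν − λ(1−4νλ)‖y‖² − 2λβ·y] ≤ K₂ − V` iff
`λ < 1/(4ν)` — here `λ = 1/(8ν)`, `K₂ = K₂(ν,C)` — so `M(s) = ∫VΦ(s)` obeys `dM/ds ≤ K₂ − M`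
(mass `∫Φ = 1`); the heat-class hypothesis (rate `C₂' < 8ν`) makes
`M(s) ≤ K (π/(1/C₂' − 1/(8ν)))^{3/2}` bounded on the whole past, and relaxing the differential
inequality from `s₁ → −∞` gives `M(s) ≤ K₂` for all `s`
(the backward-Grönwall / invariant-interval argument; cf. `ancient_gronwall` certified in
`Cruxes/MustSqueeze/Disproof.lean` §4). Technicalities: differentiate `t ↦ ∫ψG(t)` for COMPACTLY
supported `ψ = V·χ_R` only (`G ∈ C²`, `b(t,·) ∈ C¹`, `div b = 0`: all derivatives fall on `ψ`, no
decay of `∇G` needed), and let `R → ∞` using the heat-class tail. Uses H = Type-I rate (as `‖β‖ ≤ C`)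
and `div b = 0`. Size M. Leans on: `IsAdaptedBackwardKernel.{adjoint_eq,integral_eq_one,contDiffOn}`,
`VectorCalculus.IsDivFree.isWeaklyDivFree_holds`, Mathlib `integral_prod`/Gaussian integrals,
`image_le_of_deriv_right_lt_deriv_boundary` (ODE comparison). -/
theorem stub_expMoment :
    ∀ ν C : ℝ, 0 < ν → 0 ≤ C → ∃ M : ℝ, 0 < M ∧
      ∀ (t₀ T : ℝ) (b : ℝ → E3 → E3) (x₀ : E3) (G : ℝ → E3 → ℝ), t₀ < T →
        IsTypeIDrift C b t₀ T → IsAdaptedBackwardKernel ν b (Ico t₀ T) T x₀ G →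
          InHeatClass ν G t₀ T x₀ → HasExpMomentBound ν M G t₀ T x₀ := by
  sorry

/-- **`stub_gaussianUpper` — Gaussian upper bound from the moment by the local maximum principle.**
If `∫ e^{‖x−x₀‖²/(8ν(T−t))} G(t) ≤ M` at all times, then `G(t,x) ≤ C₁(T−t)^{-3/2}e^{−‖x−x₀‖²/(C₂(T−t))}`
with `(C₁,C₂)(ν,C,M)` (any `C₂ > 8ν` will come out).
Why plausibly true: fix `(t,x)`, `τ = T−t`, `r = ‖x−x₀‖/√τ`. Reverse time (`G̃(τ') = G(T−τ')` solves
the FORWARD drift–heat equation `∂G̃ = νΔG̃ + b̃·∇G̃`, the tree's class `vₜ + a·∇v − Δv = 0` after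
`x ↦ x/√ν`, `a = −b̃`) and apply Lieberman 1996 Thm 6.17 (`Lieberman1996_local_max_holds`, PROVED; its
constant depends on the drift bound and the radius cap only) on the cylinder of radius `ρ√τ`
(`ρ = 1/4`) over physical times `[t, t + 4ρ²τ] ⊂ [t,T)`, where `‖b‖ ≤ C/√(T−t') ≤ 2C/√τ`, i.e. after
rescaling the cylinder to unit size the drift bound is `A = A(ν,C)`: `G(t,x) ≤ c_L (ρ√τ)^{-5} ∫∫_{cyl} G
+ (k-term → 0)`. On the cylinder `‖x'−x₀‖ ≥ (r−2ρ)√τ` and `T−t' ≤ τ`, so the moment bound gives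
`∫_{ball} G(t') ≤ M e^{−(r−2ρ)₊²/(8ν)}`; hence `G(t,x) ≤ c(ν,C) M τ^{-3/2} e^{−(r−1/2)₊²/(8ν)} ≤
C₁τ^{-3/2}e^{−r²/C₂}`. Uses H = Type-I rate only locally (drift bound at scale `√τ`). Size M.
Leans on: `Lieberman1996_local_max_holds`, `IsDriftHeatSolutionOn` (local class: measurable drift,
`C²` slices, time-integrated equation — all from `IsAdaptedBackwardKernel` + `IsTypeIDrift`),
`ParabolicRescale`. -/
theorem stub_gaussianUpper :
    ∀ ν C M : ℝ, 0 < ν → 0 ≤ C → ∃ C₁ C₂ : ℝ, 0 < C₁ ∧ 0 < C₂ ∧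
      ∀ (t₀ T : ℝ) (b : ℝ → E3 → E3) (x₀ : E3) (G : ℝ → E3 → ℝ), t₀ < T →
        IsTypeIDrift C b t₀ T → IsAdaptedBackwardKernel ν b (Ico t₀ T) T x₀ G →
          HasExpMomentBound ν M G t₀ T x₀ → HasGaussianUpperBound C₁ C₂ G t₀ T x₀ := by
  sorry

/-- **`stub_bulkPositivity` — bulk positivity from the moment by mass-to-pointwise comparison.**
If `∫ e^{‖x−x₀‖²/(8ν(T−t))} G(t) ≤ M` at all times, then `G(t,x) ≥ c₀(T−t)^{-3/2}` whenever
`‖x−x₀‖ ≤ R√(T−t)`, with `(R,c₀)(ν,C,M)`.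
Why plausibly true: Chebyshev on the moment: `∫_{‖x'−x₀‖ > R₁√(T−t')} G(t') ≤ M e^{−R₁²/(8ν)} ≤ ½` for
`R₁² = 8ν log(2M)`, so at `t' = (t+T)/2` the ball `B(x₀, R₁√(τ/2))` (`τ = T−t`) carries mass `≥ ½`
(`∫G = 1`). In reversed time the equation runs forward from `t'` to `t` (elapsed `τ/2`, drift bound
`≤ C√2/√τ` throughout); the tree's Gaussian comparison `IsDriftHeatSolutionOn.mass_to_pointwise` /
`kernel_lower_bound` (PROVED: `(∫_{B(c,ρ/8)} u(t_b))·profile ≤ u(t,·)` on `B̄(c,3ρ/8)`, profile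
`kSubLow − gaussTail > 0` in the scale-free window `exists_kernel_window`) with `ρ/8 = R₁√(τ/2)·Λ`
(`Λ(ν,C)` large so that the age `τ/2` is small against `ρ²`) turns that mass into
`G(t,·) ≥ c₀ τ^{-3/2}` on `B(x₀, 3ρ/8) ⊇ B(x₀, R√τ)`, `R := R₁`. Uses H = Type-I rate locally. Size M.
Leans on: `IsDriftHeatSolutionOn.mass_to_pointwise`, `IsDriftHeatSolutionOn.kernel_lower_bound`,
`exists_kernel_window`, `kSubLow_le_driftKernel`, `driftKernel_le_gaussTail`. -/
theorem stub_bulkPositivity :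
    ∀ ν C M : ℝ, 0 < ν → 0 ≤ C → ∃ R c₀ : ℝ, 0 < R ∧ 0 < c₀ ∧
      ∀ (t₀ T : ℝ) (b : ℝ → E3 → E3) (x₀ : E3) (G : ℝ → E3 → ℝ), t₀ < T →
        IsTypeIDrift C b t₀ T → IsAdaptedBackwardKernel ν b (Ico t₀ T) T x₀ G →
          HasExpMomentBound ν M G t₀ T x₀ → HasBulkLowerBound R c₀ G t₀ T x₀ := by
  sorry

/-- **`stub_harnackChain` — the radius-adapted Harnack chain (LEVER 2; the card's First lemma).**
Bulk positivity `G ≥ c₀(T−t)^{-3/2}` on `‖x−x₀‖ ≤ R√(T−t)` (all `t`) upgrades to the Gaussian lower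
bound `G(t,x) ≥ c₁(T−t)^{-3/2}e^{−‖x−x₀‖²/(c₂(T−t))}` with `(c₁,c₂)(ν,C,R,c₀)`.
Why plausibly true (triage r1-1 checked the bookkeeping): fix `(t,x)`, `τ = T−t`, `r = ‖x−x₀‖/√τ > R`.
In reversed time the value at `(t,x)` is bounded BELOW through values at physical times in
`(t, (t+T)/2)` (drift `≤ C√2/√τ` there), starting from the bulk `B(x₀, R√(τ/2))` at `t' = (t+T)/2`
where `G ≥ c₀(τ/2)^{-3/2}`. Chain `N` two-point Harnack steps (tree: `exists_twoPointHarnack` from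
`Lieberman1996_local_max_holds` + `Lieberman1996_weak_harnack_holds`, and `IsTwoPointHarnackConst.chain`
/ `chain_lower_bound`, all PROVED) along the segment from `x₀` to `x` with balls of radius
`ρ = √τ/(8r)`·const and lags `γρ²`: `N ≍ r√τ/ρ ≍ r²` steps, total time `Nγρ² ≲ τ/2` — inside the
window, no room needed below `t₀`; radius × drift `= O(C/r) ≤ O(C)`, so after rescaling each ball to
unit size ONE constant `θ₀ = θ₀(ν,C)` serves every step (`IsTwoPointHarnackConst E A R₀ γ θ₀⁻¹` with
`A = A(ν,C)`, `R₀ = 1`). Result `G(t,x) ≥ θ₀^{N} c₀ (τ/2)^{-3/2} = c₁ τ^{-3/2} e^{−r² log(1/θ₀)·κ}`: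
precisely a Gaussian. Calibration: for `b = Ce/√(T−t)` the kernel is the heat kernel recentred by
`2C√(T−t)e`, comparable only with `c₁/C₁ ~ e^{−O(C²/ν)}` — consistent (θ₀-chain prefactor), no
polynomial-in-`C` claim is made. WARNING: do not use the refuted adjacent-cylinder rendering
`Lieberman1996_harnack_drift` (`not_Lieberman1996_harnack_drift_real`); use the two-point Harnack.
Uses H = Type-I rate locally. Size L. -/
theorem stub_harnackChain :
    ∀ ν C R c₀ : ℝ, 0 < ν → 0 ≤ C → 0 < R → 0 < c₀ → ∃ c₁ c₂ : ℝ, 0 < c₁ ∧ 0 < c₂ ∧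
      ∀ (t₀ T : ℝ) (b : ℝ → E3 → E3) (x₀ : E3) (G : ℝ → E3 → ℝ), t₀ < T →
        IsTypeIDrift C b t₀ T → IsAdaptedBackwardKernel ν b (Ico t₀ T) T x₀ G →
          HasBulkLowerBound R c₀ G t₀ T x₀ → HasGaussianLowerBound c₁ c₂ G t₀ T x₀ := by
  sorry

/-- **`stub_cutoffKernel` — adapted kernels with a REGULAR pole exist and lie in the heat class.**
For `ν > 0` and a jointly smooth, bounded, divergence-free drift `b` on `[t₀,T) × ℝ³` that vanishes
on `[T₁,T)` for some `T₁ ∈ (t₀,T)`, there is an adapted backward kernel `G` of `∂ₜ + b·∇ − νΔ` on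
`Ico t₀ T` with pole `(T,x₀)`, and `G ≤ K(T−t)^{-3/2}e^{−‖x−x₀‖²/(6ν(T−t))}` for some `K`.
Why plausibly true (classical linear theory, no fundamental-solution theory at a singular pole):
on `[T₁,T)` take `G :=` the backward heat kernel (`isAdaptedBackwardKernel_backwardHeatKernel`,
`isGaussianComparable_backwardHeatKernel`: exact, rate `4ν < 6ν`); on `[t₀,T₁]` solve the backward
Cauchy problem `∂ₜG + b·∇G + νΔG = 0` with the Gaussian terminal datum `G(T₁)` — bounded smooth
coefficients, finite slab: e.g. Dirichlet problems on balls `B_R` (or Duhamel/Picard for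
`G̃ = e^{ντΔ}h + ∫∇e^{ν(τ−σ)Δ}·(b̃G̃)`, `div b = 0`), monotone in `R`, squeezed between the tree's
drift-robust barriers `k₋ ⋆ h ≤ G_R ≤ k₊ ⋆ h` (`driftKernel ∓1 A` is a sub/supersolution for EVERY
measurable drift `‖a‖ ≤ A`: `driftKernel_ineq`, `driftKernelBarrier_ineq`, `driftHeat_comparison`);
interior parabolic estimates (smooth `b` on compacts) give `C²` and the pointwise equation up to the
top reversed time `t₀`; positivity from `k₋`, unit mass by `div b = 0` + Gaussian domination, and the
two pieces glue smoothly across `T₁` (`χ`-flat drift). Heat class: `k₊(σ,y) ≤ (4πσ)^{-3/2}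
e^{−(1−η)‖y‖²/(4σ)} e^{A²σ/η + 9A√σ + 2A²σ}` and Gaussian variances add under convolution, so with
`η = 1/3`: `G ≤ K (T−t)^{-3/2} e^{−‖x−x₀‖²/(6ν(T−t))}` on `[t₀,T₁]`, trivially on `[T₁,T)`.
Concentration at `x₀`: exact heat kernel near the pole (`tendsto_integral_mul_backwardHeatKernel`).
Uses H = `div b = 0` (mass) and smoothness; NOT the Type-I rate. Size L. -/
theorem stub_cutoffKernel :
    ∀ (ν t₀ T : ℝ) (b : ℝ → E3 → E3) (x₀ : E3), 0 < ν → t₀ < T →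
      IsSmoothSpaceTimeOn (Ico t₀ T) b → (∀ t ∈ Ico t₀ T, VectorCalculus.IsDivFree (b t)) →
      (∃ B : ℝ, ∀ t ∈ Ico t₀ T, ∀ x, ‖b t x‖ ≤ B) →
      (∃ T₁ ∈ Ioo t₀ T, ∀ t ∈ Ico T₁ T, ∀ x, b t x = 0) →
        ∃ G : ℝ → E3 → ℝ, IsAdaptedBackwardKernel ν b (Ico t₀ T) T x₀ G ∧ InHeatClass ν G t₀ T x₀ := by
  sorry

/-- **`stub_kernelLimit` — existence by approximation, same constants (HARDEST to formalise: needs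
local `C²` compactness for variable-coefficient parabolic equations).** If the two-sided bounds with
constants `(c₁,c₂,C₁,C₂)` hold a priori for every heat-class adapted kernel of every Type-I(`C`)
drift, and cut-off kernels exist (`CutoffKernelExists`), then every Type-I(`C`) drift on `[t₀,T)`
has, at every `x₀`, an adapted kernel on `Ico t₀ T` with pole `(T,x₀)` obeying the SAME bounds.
Why plausibly true: let `b` be Type-I (`C`) on `[t₀,T)`, `x₀ ∈ ℝ³`. For `T̂ ∈ (t₀,T)` ↑ `T` pick a smooth `χ : ℝ → [0,1]`, `χ = 1` on `(−∞, T̂−2δ]`,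
`χ = 0` on `[T̂−δ, ∞)` (`Real.smoothTransition`); `b̂ := χ·b` is jointly smooth on `[t₀,T̂)`,
divergence free, bounded (`≤ C/√(T−T̂+δ)`), vanishes on `[T̂−δ,T̂)`, and is Type-I w.r.t. the pole
`T̂` with the SAME `C`: `‖b̂(t,x)‖ ≤ C/√(T−t) ≤ C/√(T̂−t)` (triage sharpening 1 — smooth cut-off keeps
the typed class `IsTypeIDrift`). `CutoffKernelExists` gives a heat-class adapted kernel `Ĝ` of `b̂`
with pole `(T̂,x₀)`; `APrioriTwoSided` gives the two-sided bounds with `(c₁,c₂,C₁,C₂)` on `[t₀,T̂)`,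
uniformly in `T̂, δ`. On `[t₀,T'] × B_ρ` (`T' < T̂−2δ`) all `Ĝ` solve the SAME smooth-coefficient
equation with uniform sup bounds, so interior parabolic (Schauder / `W^{2,1}_p` + Sobolev) estimates
up to the top reversed time `t₀` give precompactness in `C²_x C¹_t` on compacts of `[t₀,T) × ℝ³`;
a diagonal subsequence converges to `G`: `C²`, solving `∂ₜG + b·∇G + νΔG = 0` on `Ico t₀ T`
(one-sided at `t₀`), `G ≥ c₁(…) > 0`, the two-sided bounds pass to the limit (`T̂ → T` inside the
Gaussians), unit mass by the uniform upper bound (tightness), and concentration `∫φG(t) → φ(x₀)` for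
bounded continuous `φ` from the uniform UPPER bound + unit mass alone:
`|∫φG(t) − φ(x₀)| ≤ osc_{B(x₀,η)}φ + 2‖φ‖∞ C₁∫_{‖z‖>η}(T−t)^{-3/2}e^{−‖z‖²/(C₂(T−t))}dz → 0`
(triage sharpening 2). Uses no NS structure. Size L–XL (the compactness infrastructure is not in the
tree: `SmoothParabolicHolder`, `DriftHeatInteriorLipschitz` are the nearest pieces). -/
theorem stub_kernelLimit :
    ∀ ν C c₁ c₂ C₁ C₂ : ℝ, 0 < ν → 0 ≤ C → 0 < c₁ → 0 < c₂ → 0 < C₁ → 0 < C₂ →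
      (∀ (t₀ T : ℝ) (b : ℝ → E3 → E3) (x₀ : E3) (G : ℝ → E3 → ℝ), t₀ < T →
        IsTypeIDrift C b t₀ T → IsAdaptedBackwardKernel ν b (Ico t₀ T) T x₀ G →
          InHeatClass ν G t₀ T x₀ →
            HasGaussianLowerBound c₁ c₂ G t₀ T x₀ ∧ HasGaussianUpperBound C₁ C₂ G t₀ T x₀) →
      CutoffKernelExists →
        ∀ (t₀ T : ℝ) (b : ℝ → E3 → E3) (x₀ : E3), t₀ < T → IsTypeIDrift C b t₀ T →
          ∃ G : ℝ → E3 → ℝ, IsAdaptedBackwardKernel ν b (Ico t₀ T) T x₀ G ∧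
            HasGaussianLowerBound c₁ c₂ G t₀ T x₀ ∧ HasGaussianUpperBound C₁ C₂ G t₀ T x₀ := by
  sorry

/-! ## Composition (kernel-checked; no `sorry` below this line except through the stubs in the wiring check) -/

/-- Reducible alias of the crux decl. The supporting theorems `adaptedKernelExists_of_linear` (transfer) and
`adaptedKernelExists_of_stubs` (wiring) conclude THIS alias, so that exactly one theorem of the file —
`AdaptedKernelExists_of` — concludes `AdaptedFrequency.AdaptedKernelExists` literally by name (the skeleton
audit takes "the" theorem concluding the crux). `AdaptedKernelExists' = AdaptedKernelExists` by `rfl`. -/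
abbrev AdaptedKernelExists' : Prop :=
  Summit.NavierStokesRegularity.NavierStokesRegularity.Theses.AdaptedFrequency.AdaptedKernelExists

theorem adaptedKernelExists'_iff :
    AdaptedKernelExists' ↔
      Summit.NavierStokesRegularity.NavierStokesRegularity.Theses.AdaptedFrequency.AdaptedKernelExists :=
  Iff.rfl

/-- **Stubs 1–4 ⇒ the a-priori package** (pure logic: heat class ⇒ moment `M(ν,C)` ⇒ upper bound
and bulk positivity ⇒ Harnack-chain lower bound; every constant depends on `(ν,C)` only because each
stub's constants do). -/
theorem aPriori_of (hE : ExpMomentBound) (hU : GaussianUpperFromMoment)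
    (hB : BulkPositivityFromMoment) (hH : HarnackChainLowerBound) : APrioriTwoSided := by
  intro ν C hν hC
  obtain ⟨M, hMpos, hM⟩ := hE ν C hν hC
  obtain ⟨C₁, C₂, hC₁, hC₂, hup⟩ := hU ν C M hν hC
  obtain ⟨R, c₀, hR, hc₀, hbulk⟩ := hB ν C M hν hC
  obtain ⟨c₁, c₂, hc₁, hc₂, hlow⟩ := hH ν C R c₀ hν hC hR hc₀
  refine ⟨c₁, c₂, C₁, C₂, hc₁, hc₂, hC₁, hC₂, fun t₀ T b x₀ G hT hb hG hheat => ?_⟩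
  have hmom : HasExpMomentBound ν M G t₀ T x₀ := hM t₀ T b x₀ G hT hb hG hheat
  exact ⟨hlow t₀ T b x₀ G hT hb hG (hbulk t₀ T b x₀ G hT hb hG hmom),
    hup t₀ T b x₀ G hT hb hG hmom⟩

/-- **All six stubs ⇒ C⁺** (the a-priori constants become the constants of C⁺). -/
theorem linear_of (hE : ExpMomentBound) (hU : GaussianUpperFromMoment)
    (hB : BulkPositivityFromMoment) (hH : HarnackChainLowerBound) (hX : CutoffKernelExists)
    (hL : KernelLimit) : LinearTypeIDriftKernel := by
  intro ν C hν hC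
  obtain ⟨c₁, c₂, C₁, C₂, hc₁, hc₂, hC₁, hC₂, hpack⟩ := aPriori_of hE hU hB hH ν C hν hC
  exact ⟨c₁, c₂, C₁, C₂, hc₁, hc₂, hC₁, hC₂, hL ν C c₁ c₂ C₁ C₂ hν hC hc₁ hc₂ hC₁ hC₂ hpack hX⟩

/-- **The transfer `C⁺ ⇒ crux`** (re-proved here against the tree; the ideator's and the triager's
versions live only in item evidence). From `IsTypeIBlowup u T` take `C` and a window `(t₁,T)` on
which the rate holds (`𝓝[<] T`); put `t₀ := max 0 ((t₁+T)/2) ∈ [0,T)`; on `Ico t₀ T` the velocity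
is a Type-I divergence-free smooth drift with constant `max C 0` (`IsClassicalNSSolutionOn` gives
joint smoothness and `div u = 0`); C⁺ at `(ν, max C 0)` yields the kernel, and
`isAdaptedBackwardKernel_iff` unfolds it to the crux's five inline clauses. -/
theorem adaptedKernelExists_of_linear (hLin : LinearTypeIDriftKernel) : AdaptedKernelExists' := by
  intro ν T hν hT u p hcl hLH hdec hTI x₀
  obtain ⟨C, hC⟩ := hTI
  obtain ⟨t₁, ht₁T, ht₁⟩ := mem_nhdsLT_iff_exists_Ioo_subset.1 hC
  have ht₁T' : t₁ < T := ht₁T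
  set t₀ : ℝ := max 0 ((t₁ + T) / 2) with ht₀_def
  have ht₀0 : 0 ≤ t₀ := le_max_left _ _
  have ht₀T : t₀ < T := max_lt hT (by linarith)
  have ht₁t₀ : t₁ < t₀ := lt_of_lt_of_le (show t₁ < (t₁ + T) / 2 by linarith) (le_max_right _ _)
  have hsub : Ico t₀ T ⊆ Ico 0 T := Ico_subset_Ico_left ht₀0
  -- the velocity is a Type-I divergence-free smooth drift on `[t₀, T)` with constant `max C 0`
  have hdrift : IsTypeIDrift (max C 0) u t₀ T := by
    refine ⟨hcl.smooth_velocity.mono hsub, fun t ht => hcl.divFree t (hsub ht), fun t ht x => ?_⟩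
    have htI : t ∈ Ioo t₁ T := ⟨lt_of_lt_of_le ht₁t₀ ht.1, ht.2⟩
    have hrate : ‖u t x‖ ≤ C / Real.sqrt (T - t) := ht₁ htI x
    have hsq : 0 < Real.sqrt (T - t) := Real.sqrt_pos.2 (sub_pos.2 ht.2)
    exact hrate.trans (div_le_div_of_nonneg_right (le_max_left C 0) hsq.le)
  obtain ⟨c₁, c₂, C₁, C₂, hc₁, hc₂, hC₁, hC₂, hall⟩ := hLin ν (max C 0) hν (le_max_right C 0)
  obtain ⟨G, hG, hlow, hup⟩ := hall t₀ T u x₀ ht₀T hdrift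
  refine ⟨t₀, ⟨ht₀0, ht₀T⟩, G, isAdaptedBackwardKernel_iff.1 hG, c₁, c₂, C₁, C₂, hc₁, hc₂, hC₁, hC₂,
    fun t ht x => ⟨hlow t ht x, hup t ht x⟩⟩

/-- **`AdaptedKernelExists` from the six stubs** — the kernel-checked composition of the line:
its type is literally `stub₁-statement → … → stub₆-statement → AdaptedFrequency.AdaptedKernelExists`
(hypotheses keyed by the registered stub names `Registered.stub_X`; no `sorry` in its closure). -/
theorem AdaptedKernelExists_of (hE : Registered.stub_expMoment) (hU : Registered.stub_gaussianUpper)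
    (hB : Registered.stub_bulkPositivity) (hH : Registered.stub_harnackChain)
    (hX : Registered.stub_cutoffKernel) (hL : Registered.stub_kernelLimit) :
    Summit.NavierStokesRegularity.NavierStokesRegularity.Theses.AdaptedFrequency.AdaptedKernelExists :=
  adaptedKernelExists_of_linear (linear_of hE hU hB hH hX hL)

/-- Wiring check: the registered stubs feed `AdaptedKernelExists_of` exactly as stated (this
declaration inherits the stubs' `sorry`s through them; `AdaptedKernelExists_of` itself is closed). -/
theorem adaptedKernelExists_of_stubs : AdaptedKernelExists' :=
  AdaptedKernelExists_of stub_expMoment stub_gaussianUpper stub_bulkPositivity stub_harnackChain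
    stub_cutoffKernel stub_kernelLimit

/-! ## Sanity anchors (proved): the vocabulary is not vacuous -/

/-- The zero drift is a Type-I drift with constant `0` on every window. -/
theorem isTypeIDrift_zero (t₀ T : ℝ) : IsTypeIDrift 0 (0 : ℝ → E3 → E3) t₀ T := by
  refine ⟨?_, fun t ht x => ?_, fun t ht x => by simp⟩
  · show ContDiffOn ℝ _ (fun p : ℝ × E3 => (0 : ℝ → E3 → E3) p.1 p.2) _
    simp only [Pi.zero_apply]
    exact contDiffOn_const
  · simp only [Pi.zero_apply, VectorCalculus.divergence]
    rw [fderiv_zero]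
    simp

/-- For the zero drift the backward heat kernel is an adapted kernel obeying two-sided Gaussian
bounds with `c₁ = C₁ = (4πν)^{-3/2}`, `c₂ = C₂ = 4ν` (tree: `isAdaptedBackwardKernel_backwardHeatKernel_Ico`,
`backwardHeatKernel_eq`): the conclusion of C⁺ is attained in the model case, so no stub is
contradictory there. -/
theorem linearTypeIDriftKernel_zero_drift {ν : ℝ} (hν : 0 < ν) (t₀ T : ℝ) (x₀ : E3) :
    IsAdaptedBackwardKernel ν (0 : ℝ → E3 → E3) (Ico t₀ T) T x₀ (backwardHeatKernel ν T x₀) ∧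
      HasGaussianLowerBound ((4 * Real.pi * ν) ^ (-(3:ℝ) / 2)) (4 * ν) (backwardHeatKernel ν T x₀)
        t₀ T x₀ ∧
      HasGaussianUpperBound ((4 * Real.pi * ν) ^ (-(3:ℝ) / 2)) (4 * ν) (backwardHeatKernel ν T x₀)
        t₀ T x₀ := by
  have key : ∀ t ∈ Ico t₀ T, ∀ x : E3, backwardHeatKernel ν T x₀ t x =
      (4 * Real.pi * ν) ^ (-(3:ℝ) / 2) * (T - t) ^ (-(3:ℝ) / 2) *
        Real.exp (-(‖x - x₀‖ ^ 2) / (4 * ν * (T - t))) := by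
    intro t ht x
    rw [backwardHeatKernel_eq hν.le x₀ (show t < T from ht.2) x]
    simp only [finrank_euclideanSpace_fin, Nat.cast_ofNat]
  exact ⟨isAdaptedBackwardKernel_backwardHeatKernel_Ico hν t₀ T x₀,
    fun t ht x => (key t ht x).ge, fun t ht x => (key t ht x).le⟩

end Summit.NavierStokesRegularity.NavierStokesRegularity.Cruxes.AdaptedKernelExists.SimilarityOuHarnackChain

end
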